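import Summits.BirchSwinnertonDyer.BirchSwinnertonDyer.Theses.TameQuarticManinParity
import Literature.NumberTheory.EllipticCurves.NewformCuspFourierValuationRepresentative
import Literature.NumberTheory.EllipticCurves.CuspFormLFunctionFrickeProofs
import HarnessLib

/-!
# Route `TameQuarticManinParity`, support item S49 `FrickeBoundsCuspZero` (stmt-BirchSwinnertonDyer-23791), PROVED BY NAME

The Fourier coefficients of `g ∈ S₂(Γ₀(N))` at the cusp `0 = S∞` (width `N`, parameter `q_N = e^{2πiz/N}`;
tree `fourierCoeffAtCusp N 2 ⇑g S n`) are `N⁻¹` times the coefficients at `∞` of the Fricke transform `w_N g`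
(tree `frickeInvolution N 2`, `cuspCoeff`):

  `a(g; S, n) = N⁻¹ · aₙ(w_N g)`                                         (`fourierCoeffAtCusp_S_eq`)

because `w_N = S · diag(N, 1)`, Mathlib's slash carries `det^{k−1}`, so `(w_N g)(z) = N · (g ∣₂ S)(N z)` and
`q_1(z/N) = q_N(z)`; uniqueness of `q`-expansions (Mathlib `ModularFormClass.qExpansion_coeff_unique`) at the
cusp `S∞` of the translate `g ∣₂ S` then identifies the coefficients.  Consequently, for any ring isomorphism
`ι : ℚ̄₃ ≃ ℂ`, `‖ι⁻¹ a(g; S, n)‖₃ = 3^{v₃(N)} · ‖ι⁻¹ aₙ(w_N g)‖₃` (`‖N⁻¹‖₃ = 3^{v₃(N)}`), which gives the typed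
bound `FrickeBoundsCuspZero` with equality in the constant (the refuter's normalisation audit, 2026-08-29).

BSD is NOT proved by this; the route's crux K49 `MiddleCuspAverageLaw` (stmt-23787) and U49 (23788 = ČNS Lemma 5.13
at `p = 3`, a named fact) stay OPEN, so the LINE-49 glue (23793) does not fire; this closes only the support binder
S49.  THEOREMS ONLY.  Axioms `propext`, `Classical.choice`, `Quot.sound`.
-/

set_option autoImplicit false
-- D-0017: single-problem summit, so `Summit.BirchSwinnertonDyer.BirchSwinnertonDyer.…` repeats a namespace BY DESIGN.
set_option linter.dupNamespace false

noncomputable section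

namespace Summit.BirchSwinnertonDyer.BirchSwinnertonDyer.Theorems.TameQuarticManinParity

open scoped MatrixGroups ModularForm Pointwise
open UpperHalfPlane hiding I
open Complex (I)
open Function (Periodic)
open CongruenceSubgroup Matrix.SpecialLinearGroup
open Summit.BirchSwinnertonDyer.BirchSwinnertonDyer.Theses.TameQuarticManinParity
open Literature.NumberTheory.EllipticCurves.ModularForms
open Literature.NumberTheory.Automorphic (Fuchsian.cuspWidth Fuchsian.cuspWidth_pos)

variable (N : ℕ) [NeZero N]

/-- At weight `2`, `⇑(w_N g) = ⇑g ∣[2] w_N` (`N^{1−k/2} = 1`; tree `frickeInvolution_apply_eq_slash_holds`).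
[cite: AtkinLehner1970, §2] -/
theorem coe_frickeInvolution_weight_two (g : CuspForm (Gamma0 N) 2) :
    (⇑(frickeInvolution N 2 g) : ℍ → ℂ) = ⇑g ∣[(2 : ℤ)] (glCast (frickeGL N : GL (Fin 2) ℚ) : GL (Fin 2) ℝ) := by
  rw [frickeInvolution_apply_eq_slash_holds N 2 g]
  have h0 : (1 - ((2 : ℤ) : ℝ) / 2 : ℝ) = 0 := by norm_num
  rw [h0, Real.rpow_zero, Complex.ofReal_one, one_smul]

omit [NeZero N] in
/-- The width of the cusp `0 = S∞` of `Γ₀(N)` is `N` (`N / gcd(N, 1²)`). [folklore] -/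
theorem cuspWidth_S : Fuchsian.cuspWidth N (((ModularGroup.S : SL(2, ℤ)) : Matrix (Fin 2) (Fin 2) ℤ) 1 0) = N := by
  simp [Fuchsian.cuspWidth, ModularGroup.coe_S]

/-- **`(w_N g)(z/N) = N · (g ∣₂ S)(z)`**: `w_N = S · diag(N,1)` and Mathlib's slash carries `det^{k−1} = N`.
[folklore] -/
theorem frickeInvolution_apply_div (g : CuspForm (Gamma0 N) 2) (τ : ℍ)
    (him : 0 < ((((N : ℝ)⁻¹ : ℝ) : ℂ) * (τ : ℂ)).im) :
    (⇑(frickeInvolution N 2 g) : ℍ → ℂ) ⟨(((N : ℝ)⁻¹ : ℝ) : ℂ) * (τ : ℂ), him⟩ =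
      (N : ℂ) * (⇑g ∣[(2 : ℤ)] (ModularGroup.S : SL(2, ℤ))) τ := by
  have hN0 : (N : ℂ) ≠ 0 := by exact_mod_cast NeZero.ne N
  set τ₀ : ℍ := ⟨(((N : ℝ)⁻¹ : ℝ) : ℂ) * (τ : ℂ), him⟩ with hτ₀_def
  have hτ₀ : ((τ₀ : ℍ) : ℂ) = (((N : ℝ)⁻¹ : ℝ) : ℂ) * (τ : ℂ) := rfl
  have hNτ₀ : (N : ℂ) * (τ₀ : ℂ) = τ := by
    rw [hτ₀]; push_cast; rw [mul_inv_cancel_left₀ hN0]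
  have hpt : glCast (frickeGL N : GL (Fin 2) ℚ) • τ₀ = ModularGroup.S • τ := by
    apply UpperHalfPlane.ext
    rw [coe_frickeGL_smul N τ₀, hNτ₀, UpperHalfPlane.modular_S_smul]
    show -((τ : ℂ))⁻¹ = (-(τ : ℂ))⁻¹
    rw [inv_neg]
  rw [coe_frickeInvolution_weight_two N g, ModularForm.slash_apply, σ_glCast, det_glCast_frickeGL, hpt,
    ModularForm.SL_slash_apply, ModularGroup.denom_S, denom, val_glCast_frickeGL]
  simp only [Matrix.of_apply, Matrix.cons_val', Matrix.cons_val_zero, Matrix.cons_val_one,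
    Matrix.cons_val_fin_one, Nat.abs_cast]
  push_cast
  rw [add_zero, hNτ₀]
  norm_num
  ring

/-- **`a(g; S, n) = N⁻¹ · aₙ(w_N g)`** for `g ∈ S₂(Γ₀(N))`: the Fourier coefficients at the cusp `0` (width `N`)
are those of the Fricke transform at `∞`, divided by `N`. [folklore] -/
theorem fourierCoeffAtCusp_S_eq (g : CuspForm (Gamma0 N) 2) (n : ℕ) :
    fourierCoeffAtCusp N 2 (⇑g) ModularGroup.S n = ((N : ℂ))⁻¹ * cuspCoeff (frickeInvolution N 2 g) n := by
  have hN0 : (N : ℂ) ≠ 0 := by exact_mod_cast NeZero.ne N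
  have hNpos : (0 : ℝ) < (N : ℝ) := by exact_mod_cast Nat.pos_of_ne_zero (NeZero.ne N)
  set G : CuspForm (Gamma0 N) 2 := frickeInvolution N 2 g with hG_def
  set Gt := ModularForm.translate g (mapGL ℝ (ModularGroup.S : SL(2, ℤ))) with hGt_def
  have hΓ : ((N : ℕ) : ℝ) ∈ (ConjAct.toConjAct (mapGL ℝ (ModularGroup.S : SL(2, ℤ)))⁻¹ •
      (Gamma0 N : Subgroup (GL (Fin 2) ℝ))).strictPeriods := by
    have := cuspWidth_mem_strictPeriods N (ModularGroup.S : SL(2, ℤ))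
    rwa [cuspWidth_S N] at this
  have hcoeGt : (⇑Gt : ℍ → ℂ) = ⇑g ∣[(2 : ℤ)] (ModularGroup.S : SL(2, ℤ)) := rfl
  have hw1 : (Fuchsian.cuspWidth N (((1 : SL(2, ℤ)) : Matrix (Fin 2) (Fin 2) ℤ) 1 0) : ℝ) = 1 := by
    simp [Fuchsian.cuspWidth, Nat.div_self (Nat.pos_of_ne_zero (NeZero.ne N))]
  -- the `q_N`-expansion of `g ∣₂ S` with coefficients `N⁻¹ aₘ(w_N g)`
  have hsum : ∀ τ : ℍ, HasSum (fun m : ℕ ↦ (((N : ℂ))⁻¹ * cuspCoeff G m) • Periodic.qParam (N : ℝ) (τ : ℂ) ^ m)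
      ((⇑Gt : ℍ → ℂ) τ) := by
    intro τ
    have him : 0 < ((((N : ℝ)⁻¹ : ℝ) : ℂ) * (τ : ℂ)).im := by
      rw [Complex.im_ofReal_mul]; exact mul_pos (inv_pos.2 hNpos) τ.im_pos
    set τ₀ : ℍ := ⟨(((N : ℝ)⁻¹ : ℝ) : ℂ) * (τ : ℂ), him⟩ with hτ₀_def
    have hτ₀ : ((τ₀ : ℍ) : ℂ) = (((N : ℝ)⁻¹ : ℝ) : ℂ) * (τ : ℂ) := rfl
    have hGsum := hasSum_fourierCoeffAtCusp N 2 G 1 τ₀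
    simp only [fourierCoeffAtCusp_one, hw1, SlashAction.slash_one] at hGsum
    have hq : Periodic.qParam (1 : ℝ) ((τ₀ : ℍ) : ℂ) = Periodic.qParam (N : ℝ) (τ : ℂ) := by
      simp only [Periodic.qParam, hτ₀]
      congr 1
      push_cast
      field_simp
    have hval : (⇑G : ℍ → ℂ) τ₀ = (N : ℂ) * (⇑Gt : ℍ → ℂ) τ := by
      rw [hcoeGt, hG_def]
      exact frickeInvolution_apply_div N g τ him
    rw [hq, hval] at hGsum
    have h2 := hGsum.mul_left (((N : ℂ))⁻¹)
    rw [inv_mul_cancel_left₀ hN0] at h2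
    refine h2.congr_fun ?_
    intro m
    simp only [smul_eq_mul, cuspCoeff, mul_assoc]
  have huniq := ModularFormClass.qExpansion_coeff_unique hNpos hΓ (f := Gt) hsum n
  rw [fourierCoeffAtCusp, cuspWidth_S N, ← hcoeGt, ← huniq]

/-- `‖N‖₃ = 3^{−v₃(N)}` in `ℚ̄₃`. [folklore] -/
theorem norm_natCast_padicAlgCl_three : ‖(N : PadicAlgCl 3)‖ = (3 : ℝ) ^ (-(padicValNat 3 N : ℤ)) := by
  have hN0 : (N : ℚ_[3]) ≠ 0 := by exact_mod_cast NeZero.ne N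
  rw [← map_natCast (algebraMap ℚ_[3] (PadicAlgCl 3)) N, norm_algebraMap', Padic.norm_eq_zpow_neg_valuation hN0,
    Padic.valuation_natCast]
  norm_cast

/-- `‖ι⁻¹(N⁻¹ a)‖₃ = 3^{v₃(N)} ‖ι⁻¹ a‖₃`. [folklore] -/
theorem norm_symm_inv_natCast_mul (ι : PadicAlgCl 3 ≃+* ℂ) (a : ℂ) :
    ‖ι.symm (((N : ℂ))⁻¹ * a)‖ = (3 : ℝ) ^ ((padicValNat 3 N : ℕ) : ℝ) * ‖ι.symm a‖ := by
  rw [map_mul, map_inv₀, map_natCast, norm_mul, norm_inv, norm_natCast_padicAlgCl_three N, Real.rpow_natCast,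
    zpow_neg, inv_inv, zpow_natCast]

/-- **S49 `FrickeBoundsCuspZero` BY NAME** (route `TameQuarticManinParity`, support item stmt-BirchSwinnertonDyer-23791):
`‖ι⁻¹ a(g; S, n)‖₃ ≤ 3^{v₃(N)} · B` whenever `‖ι⁻¹ aₘ(w_N g)‖₃ ≤ B` for all `m` — with equality in the constant,
from `a(g; S, n) = N⁻¹ aₙ(w_N g)`. [folklore] -/
theorem frickeBoundsCuspZero : FrickeBoundsCuspZero := by
  intro N _ g ι B hB n
  rw [fourierCoeffAtCusp_S_eq N g n, norm_symm_inv_natCast_mul N ι]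
  exact mul_le_mul_of_nonneg_left (hB n) (by positivity)

end Summit.BirchSwinnertonDyer.BirchSwinnertonDyer.Theorems.TameQuarticManinParity

end
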